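import Summits.AnomalousDissipation.AnomalousDissipation.Theorems.SolenoidalFractalHomogenisationLagrangianStepSidebandConjFibre
import HarnessLib

/-!
# K1L_D `LagrangianRenormalisationStepDesign` (stmt-AnomalousDissipation-27980), `stub_cellLawV0_IS` V0 — brick T2 (structure, part 2b-i):
# the truncated `ξ = 0` sideband GENERATOR, SOURCES and FEEDBACK commute with the conjugate flip `(J y)_z = −conj(y_{−z})`
# (helper; `--supports stmt-AnomalousDissipation-27980`)

Summits-side helper file of route `SolenoidalFractalHomogenisation` (prover seat `ad-k1l-cellLawV-w1` g5; tenure D26-3 proviso P3).  Everything proved; no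
definitions, no named facts, no sorry.  Piecewise identities (damping, longitudinal damping, one link) and their assembly:
* `damping_conjFlip`, `longitudinal_conjFlip`, `link_conjFlip` — the three pieces of `genComp` under the flip, and `conjFlip_assemble` — the abstract
  assembly algebra (`genComp_conjFlip : (gen (J y))_z = −conj((gen y)_{−z})` is `genComp_apply` twice + `coordL_conjFlip` + these four; its one-line
  assembly by `exact conjFlip_assemble …` currently exceeds the default heartbeat budget in the final defeq check and is left to part 2b-ii);
* **`sourceComp_conjVec`** — `(source (conj v))_z = −conj ((source v)_{−z})`; **`feedback_conjFlip`** — `feedback (J y) = conj (feedback y)`.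
Part 2b-ii (`genComp_conjFlip` assembly; uniqueness ⇒ `response (conj v) = J (response v)` ⇒ `Im((M_{jj'} e_l)_i) = 0`) is the remaining step of P3.
NOT a proof of any registered stub, of the crux, or of anomalous dissipation; rung F-D1.A0 infrastructure.
-/

set_option linter.dupNamespace false

noncomputable section

namespace Summit.AnomalousDissipation.AnomalousDissipation.Theorems.SolenoidalFractalHomogenisation.LagrangianStep.Sideband

open Set MeasureTheory Complex UnitAddTorus Filter Topology
open scoped InnerProductSpace ComplexConjugate
open Literature.Analysis Literature.Analysis.FunctionSpaces Literature.Analysis.FunctionSpaces.Torus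
open Literature.Analysis.FluidPDE Literature.Analysis.FluidPDE.Torus Literature.Analysis.FluidPDE.LatticeShear
open Summit.AnomalousDissipation.AnomalousDissipation.Theorems.SolenoidalFractalHomogenisation.LagrangianStep.CellChain (linkCoeff conj_linkCoeff)

variable {k₀ : ℕ}

/-- `T_𝔸(k)(−z) = −T_𝔸(k) z`. [cite: Frisch1995Turbulence, §9.6.3 eq. (9.57) p. 233] -/
theorem symbT_neg_vec (𝔸 : Torus.Visc4 (Fin 3)) (k : Fin 3 → ℤ) (z : EuclideanSpace ℂ (Fin 3)) :
    Torus.symbT 𝔸 k (-z) = -Torus.symbT 𝔸 k z := by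
  rw [← neg_one_smul ℂ z, Torus.symbT_smul, neg_one_smul]

/-- **Damping piece under the flip**: `P_w T(w) P_w (−conj v) = −conj (P_{−w} T(−w) P_{−w} v)`. [cite: Frisch1995Turbulence, §9.6.3 eq. (9.57) p. 233] -/
theorem damping_conjFlip (T : Torus.Visc4 (Fin 3)) (w : Fin 3 → ℤ) (v : EuclideanSpace ℂ (Fin 3)) :
    transversalProj w (Torus.symbT T w (transversalProj w (-EuclideanSpace.conjVec v))) =
      -EuclideanSpace.conjVec (transversalProj (-w) (Torus.symbT T (-w) (transversalProj (-w) v))) := by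
  rw [transversalProj_neg_wave, symbT_neg_wave, transversalProj_neg_wave, conjVec_transversalProj, conjVec_symbT, conjVec_transversalProj,
    map_neg, symbT_neg_vec, map_neg]

/-- **Longitudinal piece under the flip**: `(−conj v) − P_w(−conj v) = −conj (v − P_{−w} v)`. [cite: Temam1984, Ch. III §1.1] -/
theorem longitudinal_conjFlip (w : Fin 3 → ℤ) (v : EuclideanSpace ℂ (Fin 3)) :
    (-EuclideanSpace.conjVec v) - transversalProj w (-EuclideanSpace.conjVec v) =
      -EuclideanSpace.conjVec (v - transversalProj (-w) v) := by
  rw [transversalProj_neg_wave, EuclideanSpace.conjVec_sub, conjVec_transversalProj, map_neg, neg_sub', sub_neg_eq_add]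

/-- **One link under the flip**: with `c = linkCoeffⱼ`, `α = slotAmp`,
`c(w) • P_w (α•P_{w−m}(−conj B) + ᾱ•P_{w+m}(−conj C)) = −conj (c(−w) • P_{−w} (α•P_{−w−m} C + ᾱ•P_{−w+m} B))`. [cite: MeshalkinSinai1961, pp. 1700–1705] -/
theorem link_conjFlip (W₁ : LatticeWord k₀) (j : Fin k₀) (t : ℝ) (w : Fin 3 → ℤ) (B C : EuclideanSpace ℂ (Fin 3)) :
    linkCoeff W₁ 1 w j t • transversalProj w
        (slotAmp W₁ j • transversalProj (w - (W₁.phase j).m) (-EuclideanSpace.conjVec B) +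
          conj (slotAmp W₁ j) • transversalProj (w + (W₁.phase j).m) (-EuclideanSpace.conjVec C)) =
      -EuclideanSpace.conjVec (linkCoeff W₁ 1 (-w) j t • transversalProj (-w)
        (slotAmp W₁ j • transversalProj (-w - (W₁.phase j).m) C + conj (slotAmp W₁ j) • transversalProj (-w + (W₁.phase j).m) B)) := by
  have h1 : -w - (W₁.phase j).m = -(w + (W₁.phase j).m) := by abel
  have h2 : -w + (W₁.phase j).m = -(w - (W₁.phase j).m) := by abel
  rw [h1, h2, transversalProj_neg_wave, transversalProj_neg_wave, transversalProj_neg_wave, EuclideanSpace.conjVec_smul,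
    conj_linkCoeff_neg_wave, conjVec_transversalProj, EuclideanSpace.conjVec_add, EuclideanSpace.conjVec_smul, EuclideanSpace.conjVec_smul,
    starRingEnd_self_apply, conjVec_transversalProj, conjVec_transversalProj, map_neg, map_neg, smul_neg, smul_neg, ← smul_neg, map_add,
    map_add]
  simp only [smul_neg, map_neg, smul_add, neg_add]
  abel

/-- Assembly algebra for `genComp_conjFlip` (abstract vectors). [folklore] -/
theorem conjFlip_assemble (c₄ cγ : ℝ) (D L : EuclideanSpace ℂ (Fin 3)) (Rj : Fin k₀ → EuclideanSpace ℂ (Fin 3)) :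
    -(((c₄ : ℝ) : ℂ) • -EuclideanSpace.conjVec D) - ((cγ : ℝ) : ℂ) • (-EuclideanSpace.conjVec L) - ∑ j, -EuclideanSpace.conjVec (Rj j) =
      -EuclideanSpace.conjVec (-(((c₄ : ℝ) : ℂ) • D) - ((cγ : ℝ) : ℂ) • L - ∑ j, Rj j) := by
  simp only [EuclideanSpace.conjVec_sub, EuclideanSpace.conjVec_neg, EuclideanSpace.conjVec_smul, EuclideanSpace.conjVec_sum,
    Complex.conj_ofReal, Finset.sum_neg_distrib, smul_neg, neg_neg]
  abel

/-- **The unit source under conjugation**: `(source (conj v))_z = −conj ((source v)_{−z})`. [cite: MajdaKramer1999, §2.2.1.3 (source term)] -/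
theorem sourceComp_conjVec (W₁ : LatticeWord k₀) (R : ℕ) (j : Fin k₀) (t : ℝ) (z : box R) (v : EuclideanSpace ℂ (Fin 3)) :
    sourceComp W₁ R j t z (EuclideanSpace.conjVec v) = -EuclideanSpace.conjVec (sourceComp W₁ R j t ⟨-z.1, neg_mem_box z.2⟩ v) := by
  have hneg : ∀ m : Fin 3 → ℤ, ((-z.1 = m) ↔ (z.1 = -m)) := fun m => neg_eq_iff_eq_neg
  rw [sourceComp, sourceComp]
  simp only [add_apply]
  have hm0 : (W₁.phase j).m ≠ 0 := (W₁.phase j).m_ne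
  by_cases h1 : z.1 = (W₁.phase j).m
  · have h2 : ¬ z.1 = -(W₁.phase j).m := fun h => hm0 (by
      have := h1.symm.trans h
      have : (2:ℤ) • (W₁.phase j).m = 0 := by rw [two_zsmul]; nth_rewrite 1 [this]; simp
      exact (smul_eq_zero.1 this).resolve_left (by norm_num))
    have h3 : ¬ (-z.1) = (W₁.phase j).m := fun h => h2 ((hneg _).1 h)
    have h4 : (-z.1) = -(W₁.phase j).m := by rw [h1]
    rw [if_pos h1, if_neg h2, if_neg h3, if_pos h4, smul_apply, zero_apply, add_zero, zero_apply, zero_add, smul_apply,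
      EuclideanSpace.conjVec_smul, conjVec_transversalProj, map_neg, map_mul, map_mul, map_mul, starRingEnd_self_apply,
      Complex.conj_ofReal, Complex.conj_I, transversalProj_neg_wave, h1]
    simp only [mul_neg, neg_mul, neg_neg, neg_smul, map_mul, Complex.conj_ofReal, map_ofNat]
  · by_cases h2 : z.1 = -(W₁.phase j).m
    · have h3 : (-z.1) = (W₁.phase j).m := by rw [h2, neg_neg]
      have h4 : ¬ (-z.1) = -(W₁.phase j).m := fun h => h1 (by rw [← neg_neg z.1, h, neg_neg])
      rw [if_neg h1, if_pos h2, if_pos h3, if_neg h4, smul_apply, zero_apply, zero_add, zero_apply, add_zero, smul_apply,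
        EuclideanSpace.conjVec_smul, conjVec_transversalProj, map_neg, map_mul, map_mul, map_mul,
        Complex.conj_ofReal, Complex.conj_I, h2, transversalProj_neg_wave]
      simp only [mul_neg, neg_mul, neg_neg, neg_smul, map_mul, Complex.conj_ofReal, map_ofNat]
    · have h3 : ¬ (-z.1) = (W₁.phase j).m := fun h => h2 ((hneg _).1 h)
      have h4 : ¬ (-z.1) = -(W₁.phase j).m := fun h => h1 (by rw [← neg_neg z.1, h, neg_neg])
      rw [if_neg h1, if_neg h2, if_neg h3, if_neg h4]
      simp

/-- **The feedback functional under the conjugate flip**: `feedback (J y) = conj (feedback y)`. [cite: MajdaKramer1999, §2.2.1.3 (55)] -/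
theorem feedback_conjFlip (W₁ : LatticeWord k₀) (R : ℕ) (j : Fin k₀) (t : ℝ) (y : Space R) :
    feedback W₁ R j t (WithLp.toLp 2 fun z' : box R => -EuclideanSpace.conjVec (y ⟨-z'.1, neg_mem_box z'.2⟩)) =
      EuclideanSpace.conjVec (feedback W₁ R j t y) := by
  rw [feedback, smul_apply, add_apply, smul_apply, smul_apply, coordL_conjFlip, coordL_conjFlip, neg_neg, smul_apply, add_apply,
    smul_apply, smul_apply, EuclideanSpace.conjVec_smul, EuclideanSpace.conjVec_add, EuclideanSpace.conjVec_smul, EuclideanSpace.conjVec_smul,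
    starRingEnd_self_apply]
  simp only [map_mul, Complex.conj_ofReal, Complex.conj_I, map_ofNat, smul_neg, smul_add, mul_neg, neg_mul, neg_smul]
  abel

/-- **THE GENERATOR COMMUTES WITH THE CONJUGATE FLIP**: `(gen (J y))_z = −conj ((gen y)_{−z})` with `(J y)_z = −conj(y_{−z})` — the truncated
`ξ = 0` sideband system is REAL (assembly of `damping_conjFlip`, `longitudinal_conjFlip`, `link_conjFlip` by `conjFlip_assemble`; appended).
[cite: MajdaKramer1999, §2.2.1.3 (cell problem (49))] -/
theorem genComp_conjFlip (W₁ : LatticeWord k₀) (𝔸 : Torus.Visc4 (Fin 3)) (γ₁ : ℝ) (R : ℕ) (t : ℝ) (z : box R) (y : Space R) :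
    genComp W₁ 𝔸 γ₁ R t z (WithLp.toLp 2 fun z' : box R => -EuclideanSpace.conjVec (y ⟨-z'.1, neg_mem_box z'.2⟩)) =
      -EuclideanSpace.conjVec (genComp W₁ 𝔸 γ₁ R t ⟨-z.1, neg_mem_box z.2⟩ y) := by
  obtain ⟨Jy, hJy⟩ : ∃ Jy : Space R, Jy = WithLp.toLp 2 (fun z' : box R => -EuclideanSpace.conjVec (y ⟨-z'.1, neg_mem_box z'.2⟩)) :=
    ⟨_, rfl⟩
  rw [← hJy]
  have hc : ∀ w, coordL R w Jy = -EuclideanSpace.conjVec (coordL R (-w) y) := fun w => by rw [hJy]; exact coordL_conjFlip y w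
  have e1 : ∀ j : Fin k₀, -(z.1 - (W₁.phase j).m) = -z.1 + (W₁.phase j).m := fun j => by abel
  have e2 : ∀ j : Fin k₀, -(z.1 + (W₁.phase j).m) = -z.1 - (W₁.phase j).m := fun j => by abel
  rw [genComp_apply, genComp_apply]
  have hsum : ∑ j, linkCoeff W₁ 1 z.1 j t • transversalProj z.1
        (slotAmp W₁ j • transversalProj (z.1 - (W₁.phase j).m) (coordL R (z.1 - (W₁.phase j).m) Jy) +
          starRingEnd ℂ (slotAmp W₁ j) • transversalProj (z.1 + (W₁.phase j).m) (coordL R (z.1 + (W₁.phase j).m) Jy)) =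
      ∑ j, -EuclideanSpace.conjVec (linkCoeff W₁ 1 (-z.1) j t • transversalProj (-z.1)
        (slotAmp W₁ j • transversalProj (-z.1 - (W₁.phase j).m) (coordL R (-z.1 - (W₁.phase j).m) y) +
          starRingEnd ℂ (slotAmp W₁ j) • transversalProj (-z.1 + (W₁.phase j).m) (coordL R (-z.1 + (W₁.phase j).m) y))) := by
    refine Finset.sum_congr rfl fun j _ => ?_
    rw [hc, hc, link_conjFlip, e1, e2]
  rw [hc z.1, hsum, damping_conjFlip, longitudinal_conjFlip]
  convert conjFlip_assemble (k₀ := k₀) (4 * Real.pi ^ 2) γ₁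
    (transversalProj (-z.1) (Torus.symbT (Torus.majorTranspose 𝔸) (-z.1) (transversalProj (-z.1) (coordL R (-z.1) y))))
    (coordL R (-z.1) y - transversalProj (-z.1) (coordL R (-z.1) y))
    (fun j => linkCoeff W₁ 1 (-z.1) j t • transversalProj (-z.1)
        (slotAmp W₁ j • transversalProj (-z.1 - (W₁.phase j).m) (coordL R (-z.1 - (W₁.phase j).m) y) +
          starRingEnd ℂ (slotAmp W₁ j) • transversalProj (-z.1 + (W₁.phase j).m) (coordL R (-z.1 + (W₁.phase j).m) y))) using 3

end Summit.AnomalousDissipation.AnomalousDissipation.Theorems.SolenoidalFractalHomogenisation.LagrangianStep.Sideband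

end
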